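import Summits.QuantumFields.YangMills.Theorems.SwapVirialDeficitZeroModeSigmaFourSmallBallExact
import HarnessLib

/-!
# Exact zero-mode rung Z5 — the σ-TWISTED FOUR-LEADER small ball, X: at a good hub both events lie in an explicit bounded box
# (deterministic side of the RATE; free-hands support of ⟨stmt-QuantumFields-24197⟩, division of labour with w2 g56)

Consequence of parts VIII/IX: at an axial unit hub `A = α + βi` with `αβ ≠ 0`, and off the null set `{x̄ = 0} ∪ {ȳ = 0}`, the LIMIT event
`limSigma r A` and — for scales with `r·s ≤ |αβ|` — the RESCALED event `rescaledSigmaR r s A` are both contained in the bounded box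
`‖x̄‖ < 1, ‖x_⊥‖ ≤ ρ₁;  ‖ȳ‖ < 1, ‖y_⊥‖ ≤ ρ₂;  0 < z₀ < 1, ‖ζ‖ ≤ ρ₃` with `(ρ₁, ρ₂, ρ₃) = (r/|αβ|, r/|β|, 2r)` (★★ `mem_box_of_mem_limSigma`,
★★ `mem_box_of_mem_rescaledSigmaR`).  So at good hubs NO dominator is needed: volumes, shells and ball layers are those of a product of discs and
intervals with explicit radii polynomial in `1/|α|, 1/|β|` (the measure side, w2 g56, integrates these against the cone measure; the bad hubs
`|αβ| → 0` keep the dominator of parts IV–V).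
HONEST LABEL: deterministic finite-dimensional algebra (plan-level zero-mode rung of the DRAFT line «sharp-sigma»); no rate is proved here; NOT ⟨24197⟩;
own crux ⟨22884⟩ OPEN (blocked-on ⟨19935⟩); the Yang–Mills mass gap is NOT proved; no summit is proved by a line.
Width seat ym-line-sfw-p2-w3 g63 (cell ym-idea-1, free hands), `--supports stmt-QuantumFields-24197`.  THEOREMS ONLY, standard axioms, 0 `sorry`.
References: [cite: GonzalezarroyoAltes1988]; [cite: Vanbaal2001]; [cite: Luscher1983, §2]; [folklore].
-/

set_option autoImplicit false

noncomputable section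

open Quaternion Set
open scoped Quaternion RealInnerProductSpace
open Literature.MathematicalPhysics.QuantumLattice
open Literature.Analysis.Calculus (radialUnit radialUnit_def norm_radialUnit)
open Summit.QuantumFields.YangMills.Theorems.SwapTwistDeficit.ToronLog
open Summit.QuantumFields.YangMills.Theorems.SwapVirialDeficit.ZeroModeGroup

namespace Summit.QuantumFields.YangMills.Theorems.SwapVirialDeficit.ZeroModeSigma

/-! ## §45 From ratio bounds to absolute bounds inside the unit balls -/

/-- `‖x_⊥‖ ≤ ρ` from `a ≤ ρ` when `0 < ‖x̄‖ ≤ 1`. [folklore] -/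
theorem norm_trPart_le_of_trRatio_le {x : ℍ} (hx : axPart x ≠ 0) (hx1 : ‖axPart x‖ ≤ 1) {ρ : ℝ} (h : trRatio x ≤ ρ) : ‖trPart x‖ ≤ ρ := by
  have hn : 0 < ‖axPart x‖ := norm_pos_iff.2 hx
  have e : ‖trPart x‖ = trRatio x * ‖axPart x‖ := by rw [trRatio, div_mul_cancel₀ _ hn.ne']
  have ha := (ratios_nonneg x 0).1
  rw [e]
  nlinarith [mul_le_mul_of_nonneg_left hx1 ha]

/-- `‖ζ‖ ≤ ρ` from `c ≤ ρ` when `0 < |z₀| ≤ 1`. [folklore] -/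
theorem norm_im_le_of_imRatio_le {z : ℍ} (hz : z.re ≠ 0) (hz1 : |z.re| ≤ 1) {ρ : ℝ} (h : imRatio z ≤ ρ) : ‖z.im‖ ≤ ρ := by
  have hn : 0 < ‖(z.re : ℍ)‖ := by rw [Quaternion.norm_coe, Real.norm_eq_abs]; exact abs_pos.2 hz
  have e : ‖z.im‖ = imRatio z * ‖(z.re : ℍ)‖ := by rw [imRatio, div_mul_cancel₀ _ hn.ne']
  have hc := (ratios_nonneg 0 z).2
  have hz1' : ‖(z.re : ℍ)‖ ≤ 1 := by rwa [Quaternion.norm_coe, Real.norm_eq_abs]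
  rw [e]
  nlinarith [mul_le_mul_of_nonneg_left hz1' hc]

/-! ## §46 The boxes -/

/-- ★★ **THE LIMIT EVENT LIES IN AN EXPLICIT BOX**: for an axial unit hub with `αβ ≠ 0` and `w = ((x,y),z) ∈ limSigma r A` with `x̄, ȳ ≠ 0`:
`‖x̄‖ < 1`, `‖x_⊥‖ ≤ r/(2|αβ|)`, `‖ȳ‖ < 1`, `‖y_⊥‖ ≤ r/(2|β|)`, `0 < z₀ < 1`, `‖ζ‖ ≤ r`. [folklore] -/
theorem mem_box_of_mem_limSigma {r : ℝ} {A : ℍ} (hA : ‖A‖ = 1) (hJ : A.imJ = 0) (hK : A.imK = 0) (hαβ : A.re * A.imI ≠ 0)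
    {w : (ℍ × ℍ) × ℍ} (hx : axPart w.1.1 ≠ 0) (hy : axPart w.1.2 ≠ 0) (hw : w ∈ limSigma r A) :
    ‖axPart w.1.1‖ < 1 ∧ ‖trPart w.1.1‖ ≤ r / (2 * |A.re * A.imI|) ∧ ‖axPart w.1.2‖ < 1 ∧ ‖trPart w.1.2‖ ≤ r / (2 * |A.imI|) ∧
      (0 < w.2.re ∧ w.2.re < 1) ∧ ‖w.2.im‖ ≤ r := by
  obtain ⟨hc, hb, ha⟩ := ratios_le_of_mem_limSigma hA hJ hK hx hw
  obtain ⟨-, ⟨hx1, hy1⟩, hz1, hz⟩ := (mem_limSigma_iff r A w).1 hw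
  have hβ : 0 < |A.imI| := abs_pos.2 (right_ne_zero_of_mul hαβ)
  have hp : 0 < |A.re * A.imI| := abs_pos.2 hαβ
  rw [Quaternion.norm_coe, Real.norm_eq_abs] at hz1
  refine ⟨hx1, norm_trPart_le_of_trRatio_le hx hx1.le ?_, hy1, norm_trPart_le_of_trRatio_le hy hy1.le ?_, ⟨hz, (abs_lt.1 hz1).2⟩,
    norm_im_le_of_imRatio_le hz.ne' hz1.le hc⟩
  · rw [le_div_iff₀ (by positivity)]; linarith
  · rw [le_div_iff₀ (by positivity)]; linarith

/-- ★★ **THE RESCALED EVENT LIES IN AN EXPLICIT BOX** (good hub, `0 < s`, `r·s ≤ |αβ|`): for `w ∈ rescaledSigmaR r s A` with `x̄, ȳ ≠ 0`: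
`‖x̄‖ < 1`, `‖x_⊥‖ ≤ r/|αβ|`, `‖ȳ‖ < 1`, `‖y_⊥‖ ≤ r/|β|`, `0 < z₀ < 1`, `‖ζ‖ ≤ 2r`. [folklore] -/
theorem mem_box_of_mem_rescaledSigmaR {r s : ℝ} {A : ℍ} (hA : ‖A‖ = 1) (hJ : A.imJ = 0) (hK : A.imK = 0) (hαβ : A.re * A.imI ≠ 0)
    {w : (ℍ × ℍ) × ℍ} (hx : axPart w.1.1 ≠ 0) (hy : axPart w.1.2 ≠ 0) (hs : 0 < s) (hrs : r * s ≤ |A.re * A.imI|)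
    (hw : w ∈ rescaledSigmaR r s A) :
    ‖axPart w.1.1‖ < 1 ∧ ‖trPart w.1.1‖ ≤ r / |A.re * A.imI| ∧ ‖axPart w.1.2‖ < 1 ∧ ‖trPart w.1.2‖ ≤ r / |A.imI| ∧
      (0 < w.2.re ∧ w.2.re < 1) ∧ ‖w.2.im‖ ≤ 2 * r := by
  obtain ⟨hz, hc, hb, ha⟩ := ratios_le_of_mem_rescaledSigmaR hA hJ hK hx hy hs hrs hw
  obtain ⟨-, ⟨hbx, hby⟩, hbz⟩ := (mem_rescaledSigmaR_iff r s A w).1 hw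
  have hβ : 0 < |A.imI| := abs_pos.2 (right_ne_zero_of_mul hαβ)
  have hp : 0 < |A.re * A.imI| := abs_pos.2 hαβ
  have hx1 : ‖axPart w.1.1‖ < 1 := lt_of_le_of_lt (norm_axPart_le_norm_dilate s _) hbx
  have hy1 : ‖axPart w.1.2‖ < 1 := lt_of_le_of_lt (norm_axPart_le_norm_dilate s _) hby
  have hz1 : |w.2.re| < 1 := lt_of_le_of_lt (abs_re_le_norm_dilateIm s _) hbz
  refine ⟨hx1, norm_trPart_le_of_trRatio_le hx hx1.le ?_, hy1, norm_trPart_le_of_trRatio_le hy hy1.le ?_, ⟨hz, (abs_lt.1 hz1).2⟩,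
    norm_im_le_of_imRatio_le hz.ne' hz1.le hc⟩
  · rw [le_div_iff₀ hp]; linarith
  · rw [le_div_iff₀ hβ]; linarith

/-- ★★ **Both events in ONE box at a good hub** (`0 < s`, `r·s ≤ |αβ|`, `αβ ≠ 0`, `x̄, ȳ ≠ 0`): membership in either event puts `w` in the box
with radii `(r/|αβ|, r/|β|, 2r)` — the set the measure side integrates shells and ball layers over. [folklore] -/
theorem mem_box_of_mem_union {r s : ℝ} {A : ℍ} (hA : ‖A‖ = 1) (hJ : A.imJ = 0) (hK : A.imK = 0) (hαβ : A.re * A.imI ≠ 0)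
    {w : (ℍ × ℍ) × ℍ} (hx : axPart w.1.1 ≠ 0) (hy : axPart w.1.2 ≠ 0) (hs : 0 < s) (hrs : r * s ≤ |A.re * A.imI|)
    (hw : w ∈ rescaledSigmaR r s A ∪ limSigma r A) :
    ‖axPart w.1.1‖ < 1 ∧ ‖trPart w.1.1‖ ≤ r / |A.re * A.imI| ∧ ‖axPart w.1.2‖ < 1 ∧ ‖trPart w.1.2‖ ≤ r / |A.imI| ∧
      (0 < w.2.re ∧ w.2.re < 1) ∧ ‖w.2.im‖ ≤ 2 * r := by
  rcases hw with hw | hw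
  · exact mem_box_of_mem_rescaledSigmaR hA hJ hK hαβ hx hy hs hrs hw
  · obtain ⟨h1, h2, h3, h4, h5, h6⟩ := mem_box_of_mem_limSigma hA hJ hK hαβ hx hy hw
    have hβ : 0 < |A.imI| := abs_pos.2 (right_ne_zero_of_mul hαβ)
    have hp : 0 < |A.re * A.imI| := abs_pos.2 hαβ
    have hr : 0 ≤ r := (norm_nonneg _).trans h6
    refine ⟨h1, h2.trans ?_, h3, h4.trans ?_, h5, h6.trans (by linarith)⟩
    · rw [div_le_div_iff₀ (by positivity) hp]; nlinarith
    · rw [div_le_div_iff₀ (by positivity) hβ]; nlinarith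

end Summit.QuantumFields.YangMills.Theorems.SwapVirialDeficit.ZeroModeSigma

end
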